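import Literature.AlgebraicGeometry.AbelianSchemes.GraphPointResidueField
import Literature.AlgebraicGeometry.AbelianSchemes.PoincareFamilyGraphFormallyUnramified
import Mathlib.AlgebraicGeometry.Sites.Fpqc
import HarnessLib

/-!
# (Mc) N3′ step S-f in ANY characteristic — the level-0 graph point DESCENDS from `κ(t)^alg` to `κ(t)` by fpqc descent:
# for EVERY point `t ∈ T′` there is `y₀ : Spec κ(t) → Â′` over `S′` with `(1 × y₀)^*𝒫′ ≅ (1 × ι_t)^*ℒ` ([MumfordAV1970] §13, level 0)

Layer `Literature/AlgebraicGeometry/AbelianSchemes`, namespace `Literature.AlgebraicGeometry.AbelianSchemes.AbelianSchemeOver`.  THEOREMS ONLY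
(no definition, no named fact, no instance, no notation, no `sorry`).  Cell `hodgecm-mathlib` (D-0151), P6 «MOD programme», deal (s2-D)
organ (P2) (LEAD F0P6-plan (g2) M-25 / M-28; prover seat B-p04 (g39)); ★ `GraphPointResidueField` untouched.

★ `exists_graphPoint_residueField` descends the level-0 graph point from `Ω = κ(t)^alg` to `κ(t)` by GALOIS descent and therefore asks
`char κ(t) = 0` (`Ω^{Gal} = κ(t)`).  Over an imperfect residue field Galois descent stops at the perfect closure; this file replaces it
by fpqc DESCENT OF MORPHISMS along `Spec Ω → Spec κ(t)` (flat, surjective, quasi-compact ⇒ an effective epimorphism of schemes — Mathlib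
`AlgebraicGeometry/Sites/Fpqc`; [GortzWedhorn2020] Thm. 14.72 «representable functors are fpqc sheaves»): the descent datum «the two
pull-backs of `y` to any `Z ⇉ Spec Ω` equalised by `Spec Ω → Spec κ(t)` agree» holds because both are graph points over `Z` for the SAME
module (★ `nonempty_graphIso_precomp`) and points of `Â′` are DETECTED by `𝒫′` on all test objects — the hypothesis `hinjT`, which is ★
`PoincareFamilyPointsInjective.eq_of_nonempty_pullback_poincare_iso` «`(1 × g₁)^*𝒫 ≅ (1 × g₂)^*𝒫 ⇒ g₁ = g₂`» for `Â′ = A′/K(L′)`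
([MumfordAV1970] §13 p. 125 «the map is injective»).  The graph ISOMORPHISM then descends as before (★ «`Pic(X) ↪ Pic(X_Ω)`»).
* **`exists_graphPoint_residueField_of_pointsInjective`** — ★ `exists_graphPoint_residueField` with `[CharZero (κ(t))]` REMOVED: the
  inputs are the level-0 statement over algebraically closed fields (`hlev0`, the conclusion of ★ `exists_graphPoint_of_fibrewisePicZero_of_eq`
  letter for letter; [MumfordAV1970] §8 Thm. 1 — ★ in characteristic `0`, by transport from `ℂ`) and the all-test-object detection `hinjT`
  (currency of ★ `eq_of_nonempty_pullback_poincare_iso`) in place of the geometric-point uniqueness `hinj`.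
HC_CM is proved only modulo the 2 remaining named inputs (hLiu418, h413); this file asserts nothing about HC and is count-neutral.

## References
* [MumfordAV1970] D. Mumford, *Abelian Varieties* (1970), §8 Theorem 1 (p. 77); §13 (proof of the Thm., pp. 125–130).
* [GortzWedhorn2020] U. Görtz, T. Wedhorn, *Algebraic Geometry I*, 2nd ed. (2020), Thm. 14.72 (descent of morphisms), Prop. 5.4 (p. 123), Section (4.7).
* [GortzWedhorn2023] U. Görtz, T. Wedhorn, *Algebraic Geometry II* (2023), Thm. 24.66 (1) (p. 405).
* [StacksProject] The Stacks Project, Tag 023Q (fpqc descent of morphisms).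
-/

set_option autoImplicit false

noncomputable section

open CategoryTheory CategoryTheory.Limits AlgebraicGeometry MonoidalCategory CartesianMonoidalCategory

-- `(A.fibre s).toAbelianVariety.X.left = pullback A.X.hom s = (A.X ⊗ Over.mk s).left` hold by `rfl` only.
set_option backward.isDefEq.respectTransparency false

namespace Literature.AlgebraicGeometry.AbelianSchemes

namespace AbelianSchemeOver

open Literature.AlgebraicGeometry.Motives Literature.AlgebraicGeometry.AbelianVarieties
  Literature.AlgebraicGeometry.Modules Literature.AlgebraicGeometry.Morphisms
open scoped MonObj

variable {S' : Scheme.{0}} (A' : AbelianSchemeOver S')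

/-- **The LEVEL-0 GRAPH POINT OVER THE RESIDUE FIELD OF AN ARBITRARY POINT, ANY CHARACTERISTIC.**  In the setting of ★ `GraphPointLevelZero`
(`A′/S′`, rank-one `L′` with ample geometric fibre classes, `π : A′ → Â′`, rank-one `𝒫′` with `(1 × π)^*𝒫′ ≅ Λ(L′)`, a base `T′ → S′`, a
rigidified `ℒ` on `A′ ×_{S′} T′` fibrewise in `Pic⁰`) assume that LEVEL 0 holds over algebraically closed fields (`hlev0`: the conclusion of ★ `exists_graphPoint_of_fibrewisePicZero_of_eq`
letter for letter — [MumfordAV1970] §8 Theorem 1, in the tree for `char Ω = 0`) and that points of `Â′` are detected by `𝒫′` on ALL test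
objects (`hinjT`, ★ `eq_of_nonempty_pullback_poincare_iso`).  Then for every `t ∈ T′` there is `y₀ : Spec κ(t) → Â′` over `S′` with
`(1_{A′} × y₀)^*𝒫′ ≅ (1_{A′} × ι_t)^*ℒ` on `A′_{κ(t)}` — the level-0 point over `κ(t)^alg` (★ `exists_graphPoint_of_fibrewisePicZero_of_eq`)
descends along the effective epimorphism `Spec κ(t)^alg → Spec κ(t)` (fpqc descent of morphisms, descent datum from `hinjT`), and the
isomorphism descends by ★ `nonempty_iso_of_nonempty_iso_pullback_baseChangeFst` through ★ `fibreFieldChangeIso`.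
[cite: MumfordAV1970, §8 Theorem 1 (p. 77) and §13 (proof of the Thm., pp. 125–130)] [cite: GortzWedhorn2020, Thm. 14.72]
[cite: GortzWedhorn2020, Prop. 5.4 (p. 123)] [cite: GortzWedhorn2023, Thm. 24.66 (1) (p. 405)] -/
theorem exists_graphPoint_residueField_of_pointsInjective
    (hat : AbelianSchemeOver S') (P : (A'.prodLeft hat).Modules) (hP1 : HasRank P 1)
    {T' : Over S'} (ℒ : A'.RigidifiedLineBundle T'.hom)
    (hlev0 : ∀ ⦃Ω : Type⦄ [Field Ω] [IsAlgClosed Ω] (s : Spec (.of Ω) ⟶ S') (x : Spec (.of Ω) ⟶ T'.left) (hs : x ≫ T'.hom = s),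
      ∃ y : Over.mk s ⟶ hat.X,
        Nonempty ((Scheme.Modules.pullback (A'.baseChangeToProd hat s y.left (Over.w y))).obj P ≅
          (Scheme.Modules.pullback (A'.X ◁ (Over.homMk x hs : Over.mk s ⟶ T')).left).obj ℒ.L))
    (hinjT : ∀ ⦃T : Over S'⦄ (y y' : T ⟶ hat.X),
      Nonempty ((Scheme.Modules.pullback (A'.baseChangeToProd hat T.hom y.left (Over.w y))).obj P ≅
        (Scheme.Modules.pullback (A'.baseChangeToProd hat T.hom y'.left (Over.w y'))).obj P) → y = y')
    (t : T'.left) :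
    ∃ y₀ : Over.mk (T'.left.fromSpecResidueField t ≫ T'.hom) ⟶ hat.X,
      Nonempty ((Scheme.Modules.pullback (A'.baseChangeToProd hat (T'.left.fromSpecResidueField t ≫ T'.hom) y₀.left (Over.w y₀))).obj P ≅
        (Scheme.Modules.pullback (A'.X ◁ (Over.homMk (T'.left.fromSpecResidueField t) rfl :
          Over.mk (T'.left.fromSpecResidueField t ≫ T'.hom) ⟶ T')).left).obj ℒ.L) := by
  classical
  -- the residue field `κ`, its algebraic closure `Ω`, the points `x₀ : Spec κ → T′`, `xΩ : Spec Ω → T′`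
  let κ : Type := T'.left.residueField t
  let Ω : Type := AlgebraicClosure κ
  let emb : κ →+* Ω := algebraMap κ Ω
  let x₀ : Spec (.of κ) ⟶ T'.left := T'.left.fromSpecResidueField t
  let s₀ : Spec (.of κ) ⟶ S' := x₀ ≫ T'.hom
  let xΩ : Spec (.of Ω) ⟶ T'.left := Spec.map (CommRingCat.ofHom emb) ≫ x₀
  let sΩ : Spec (.of Ω) ⟶ S' := Spec.map (CommRingCat.ofHom emb) ≫ s₀
  have hsΩ : xΩ ≫ T'.hom = sΩ := Category.assoc _ _ _
  let xq₀ : Over.mk s₀ ⟶ T' := Over.homMk x₀ rfl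
  let xqΩ : Over.mk sΩ ⟶ T' := Over.homMk xΩ hsΩ
  let jq : Over.mk sΩ ⟶ Over.mk s₀ := Over.homMk (Spec.map (CommRingCat.ofHom emb)) rfl
  have hjqx : jq ≫ xq₀ = xqΩ := by ext; rfl
  -- level 0 over `Ω`
  obtain ⟨y, ⟨eΩ⟩⟩ := hlev0 sΩ xΩ hsΩ
  -- (b′) the DESCENT DATUM along `Spec Ω → Spec κ`: two `Z`-points of `Spec Ω` with the same image in `Spec κ` give the same point
  -- of `Â′`, because both composites are graph points over `Z` for the same module (★ `nonempty_graphIso_precomp`) and graph points are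
  -- detected by `𝒫′` on ALL test objects (`hinjT`, ★ `eq_of_nonempty_pullback_poincare_iso`)
  have hdatum : ∀ {Z : Scheme.{0}} (g₁ g₂ : Z ⟶ Spec (.of Ω)),
      g₁ ≫ Spec.map (CommRingCat.ofHom emb) = g₂ ≫ Spec.map (CommRingCat.ofHom emb) → g₁ ≫ y.left = g₂ ≫ y.left := by
    intro Z g₁ g₂ hg
    have hs : g₂ ≫ sΩ = g₁ ≫ sΩ := by
      change g₂ ≫ Spec.map (CommRingCat.ofHom emb) ≫ s₀ = g₁ ≫ Spec.map (CommRingCat.ofHom emb) ≫ s₀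
      rw [← Category.assoc, ← hg, Category.assoc]
    let γ₁ : Over.mk (g₁ ≫ sΩ) ⟶ Over.mk sΩ := Over.homMk g₁ rfl
    let γ₂ : Over.mk (g₁ ≫ sΩ) ⟶ Over.mk sΩ := Over.homMk g₂ hs
    have hγx : γ₁ ≫ xqΩ = γ₂ ≫ xqΩ := by
      ext
      change g₁ ≫ Spec.map (CommRingCat.ofHom emb) ≫ x₀ = g₂ ≫ Spec.map (CommRingCat.ofHom emb) ≫ x₀
      rw [← Category.assoc, hg, Category.assoc]
    have h₁ := A'.nonempty_graphIso_precomp hat P ℒ γ₁ xqΩ y ⟨eΩ⟩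
    have h₂ := A'.nonempty_graphIso_precomp hat P ℒ γ₂ xqΩ y ⟨eΩ⟩
    rw [hγx] at h₁
    obtain ⟨e₁⟩ := h₁
    obtain ⟨e₂⟩ := h₂
    have hγy : γ₁ ≫ y = γ₂ ≫ y := hinjT (γ₁ ≫ y) (γ₂ ≫ y) ⟨e₁ ≪≫ e₂.symm⟩
    exact congrArg (fun k => CommaMorphism.left k) hγy
  -- (c′) fpqc DESCENT of the point: `Spec Ω → Spec κ` is flat, surjective and quasi-compact, hence an effective epimorphism of schemes
  -- (Mathlib), so `y` descends to `y₀ : Spec κ → Â′` over `S′`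
  haveI : Surjective (Spec.map (CommRingCat.ofHom emb)) := by
    haveI : Subsingleton ↥(Spec (CommRingCat.of κ)) := inferInstanceAs (Subsingleton (PrimeSpectrum κ))
    exact ⟨fun x => ⟨IsLocalRing.closedPoint Ω, Subsingleton.elim _ _⟩⟩
  haveI : Flat (Spec.map (CommRingCat.ofHom emb)) := by
    rw [HasRingHomProperty.Spec_iff (P := @Flat)]
    change (algebraMap κ Ω).Flat
    rw [RingHom.flat_algebraMap_iff]
    infer_instance
  let y₀' : Spec (.of κ) ⟶ hat.X.left :=
    EffectiveEpi.desc (Spec.map (CommRingCat.ofHom emb)) y.left (fun g₁ g₂ hg => hdatum g₁ g₂ hg)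
  have hy₀' : Spec.map (CommRingCat.ofHom emb) ≫ y₀' = y.left := EffectiveEpi.fac _ _ _
  have hw : y₀' ≫ hat.X.hom = s₀ := by
    apply eq_of_specMap_comp_eq emb
    rw [← Category.assoc, hy₀']
    exact Over.w y
  let y₀ : Over.mk s₀ ⟶ hat.X := Over.homMk y₀' hw
  have hjqy : jq ≫ y₀ = y := by ext; exact hy₀'
  refine ⟨y₀, ?_⟩
  -- (d) the graph isomorphism descends: the fibre `X₀ = A′_{κ(t)}` and its base change to `Ω`
  let X₀ : AbelianVariety κ := (A'.fibre s₀).toAbelianVariety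
  let πΩ : (X₀.baseChange Ω).X.left ⟶ X₀.X.left := pullback.fst X₀.X.hom (AbelianVariety.bcSpec κ Ω)
  have hπΩ : πΩ = pullback.fst X₀.X.hom (AbelianVariety.bcSpec κ Ω) := rfl
  haveI : IsDominant πΩ := by
    change IsDominant (baseChangeHomFst (algebraMap κ Ω) X₀.X)
    exact AbelianVariety.isDominant_baseChangeHomFst_along (algebraMap κ Ω) X₀
  let e := A'.fibreFieldChangeIso emb s₀
  -- `πΩ = e ≫ (1 × jq)`
  have hwE : AbelianVariety.Hom.toSchemeHom e.hom ≫ (A'.fibre (specAlong emb ≫ s₀)).toAbelianVariety.X.hom =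
      (X₀.baseChangeAlong emb).X.hom := Over.w e.hom.hom.hom.hom
  have hπ : πΩ = AbelianVariety.Hom.toSchemeHom e.hom ≫ (A'.X ◁ jq).left := by
    apply pullback.hom_ext
    · rw [Category.assoc]
      exact (A'.fibreFieldChangeIso_hom_toSchemeHom_fst emb s₀).symm.trans
        (congrArg (fun k => AbelianVariety.Hom.toSchemeHom e.hom ≫ k) (Over.whiskerLeft_left_fst (R := A'.X) jq).symm)
    · rw [Category.assoc]
      calc πΩ ≫ pullback.snd A'.X.hom s₀
          = pullback.snd X₀.X.hom (AbelianVariety.bcSpec κ Ω) ≫ AbelianVariety.bcSpec κ Ω := pullback.condition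
        _ = (AbelianVariety.Hom.toSchemeHom e.hom ≫ (A'.fibre (specAlong emb ≫ s₀)).toAbelianVariety.X.hom) ≫
              Spec.map (CommRingCat.ofHom emb) := by rw [hwE]; rfl
        _ = AbelianVariety.Hom.toSchemeHom e.hom ≫ pullback.snd A'.X.hom sΩ ≫ jq.left := by rw [Category.assoc]; rfl
        _ = AbelianVariety.Hom.toSchemeHom e.hom ≫ (A'.X ◁ jq).left ≫ pullback.snd A'.X.hom s₀ :=
              congrArg (fun k => AbelianVariety.Hom.toSchemeHom e.hom ≫ k) (Over.whiskerLeft_left_snd (R := A'.X) jq).symm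
  -- the two rank-one modules on `X₀` and their pull-backs to `X₀ ⊗ Ω`
  have hb₀ : A'.baseChangeToProd hat s₀ y₀.left (Over.w y₀) = (A'.X ◁ y₀).left := A'.baseChangeToProd_eq_whiskerLeft_left hat y₀
  have hbΩ : A'.baseChangeToProd hat sΩ y.left (Over.w y) = (A'.X ◁ y).left := A'.baseChangeToProd_eq_whiskerLeft_left hat y
  have hM₀ : HasRank ((Scheme.Modules.pullback (A'.X ◁ y₀).left).obj P) 1 := hasRank_pullback _ hP1
  have hN₀ : HasRank ((Scheme.Modules.pullback (A'.X ◁ xq₀).left).obj ℒ.L) 1 := hasRank_pullback _ ℒ.hasRank_one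
  have hy_comp : (A'.X ◁ jq).left ≫ (A'.X ◁ y₀).left = (A'.X ◁ y).left := by rw [← A'.whiskerLeft_comp_left, hjqy]
  have hx_comp : (A'.X ◁ jq).left ≫ (A'.X ◁ xq₀).left = (A'.X ◁ xqΩ).left := by rw [← A'.whiskerLeft_comp_left, hjqx]
  let isoM : (Scheme.Modules.pullback πΩ).obj ((Scheme.Modules.pullback (A'.X ◁ y₀).left).obj P) ≅
      (Scheme.Modules.pullback (AbelianVariety.Hom.toSchemeHom e.hom)).obj ((Scheme.Modules.pullback (A'.X ◁ y).left).obj P) :=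
    (Scheme.Modules.pullbackCongr hπ).app _ ≪≫
      ((Scheme.Modules.pullbackComp (AbelianVariety.Hom.toSchemeHom e.hom) (A'.X ◁ jq).left).app _).symm ≪≫
      (Scheme.Modules.pullback (AbelianVariety.Hom.toSchemeHom e.hom)).mapIso
        ((Scheme.Modules.pullbackComp (A'.X ◁ jq).left (A'.X ◁ y₀).left).app P ≪≫ (Scheme.Modules.pullbackCongr hy_comp).app P)
  let isoN : (Scheme.Modules.pullback πΩ).obj ((Scheme.Modules.pullback (A'.X ◁ xq₀).left).obj ℒ.L) ≅
      (Scheme.Modules.pullback (AbelianVariety.Hom.toSchemeHom e.hom)).obj ((Scheme.Modules.pullback (A'.X ◁ xqΩ).left).obj ℒ.L) :=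
    (Scheme.Modules.pullbackCongr hπ).app _ ≪≫
      ((Scheme.Modules.pullbackComp (AbelianVariety.Hom.toSchemeHom e.hom) (A'.X ◁ jq).left).app _).symm ≪≫
      (Scheme.Modules.pullback (AbelianVariety.Hom.toSchemeHom e.hom)).mapIso
        ((Scheme.Modules.pullbackComp (A'.X ◁ jq).left (A'.X ◁ xq₀).left).app ℒ.L ≪≫ (Scheme.Modules.pullbackCongr hx_comp).app ℒ.L)
  let eΩ' : (Scheme.Modules.pullback (A'.X ◁ y).left).obj P ≅ (Scheme.Modules.pullback (A'.X ◁ xqΩ).left).obj ℒ.L :=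
    (Scheme.Modules.pullbackCongr hbΩ.symm).app P ≪≫ eΩ
  have hdesc : Nonempty ((Scheme.Modules.pullback (A'.X ◁ y₀).left).obj P ≅ (Scheme.Modules.pullback (A'.X ◁ xq₀).left).obj ℒ.L) :=
    nonempty_iso_of_nonempty_iso_pullback_baseChangeFst Ω X₀ πΩ hπΩ hM₀ hN₀
      ⟨isoM ≪≫ (Scheme.Modules.pullback (AbelianVariety.Hom.toSchemeHom e.hom)).mapIso eΩ' ≪≫ isoN.symm⟩
  obtain ⟨e₀⟩ := hdesc
  exact ⟨(Scheme.Modules.pullbackCongr hb₀).app P ≪≫ e₀⟩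

end AbelianSchemeOver

end Literature.AlgebraicGeometry.AbelianSchemes

end
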